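import Summits.PneNP.PneNP.Theses.ExpanderLinearGenerators
import Summits.PneNP.PneNP.Theorems.ExpanderLinearGeneratorsLinearGeneratorModPFregeHardMod2Vacuous
import Summits.PneNP.PneNP.Theorems.ExpanderLinearGeneratorsLinearGeneratorDepthFregeHardNonvacuous
import Mathlib.Algebra.Polynomial.Eval.Degree
import HarnessLib

/-!
# Under `LinearGeneratorModPFregeHard`, `F_d(MOD_p)` is not polynomially bounded on the explicit
Margulis–Tseitin tautologies, for EVERY depth `d` (item stmt-PneNP-11444 ⇒ Krajíček's
Problem 15.6.1 for `textbookFrege(MOD_p)`)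

Support file for item `stmt-PneNP-11444`
(`Summit.PneNP.PneNP.Theses.ExpanderLinearGenerators.LinearGeneratorModPFregeHard`).  The
Literature predicate `FregeSystem.IsModDepthPolyBoundedOn F p d T` (`FregeMod.lean`: some
polynomial `q` bounds, for every tautology `φ ∈ T`, the size of some depth-`d`
`F(MOD_p)`-proof of `ofPropForm φ`) is the shape in which Problem 15.6.1 ("superpolynomial lower
bounds for `AC⁰[p]`-Frege") is catalogued.  This file derives from the crux its consequence in
that vocabulary, on ONE explicit class of tautologies and uniformly in the depth:

* `margulisTseitinTargets` — the class `T` of the formulas `¬ ofCNF (sumEncoding 1 E)` for the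
  `16`-sparse `(n^(1/200), 12)`-boundary-expanding unsolvable systems on `n ≥ 2^200` variables
  (inhabited for every such `n` by the Margulis–Tseitin systems of
  `…DepthFregeHardNonvacuous.lean`); all its members are tautologies
  (`isTautology_of_mem_margulisTseitinTargets`) of size polynomial in `n`;
* `not_isModDepthPolyBoundedOn_of_linearGeneratorModPFregeHard` — **if the crux holds then for
  every odd prime `p` and EVERY depth `d`, `textbookFrege_d(MOD_p)` is not polynomially bounded
  on `T`**: a polynomial bound `q(|φ|) ≤ B·K^D·(n+1)^{16 D}` on the size of depth-`d` proofs of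
  the instance at `n` variables contradicts the crux's `2^(n^ε)` for large `n`
  (`ModTwo.exists_nat_poly_lt_two_rpow`).  No existence of proofs is needed: the
  polynomial-boundedness hypothesis supplies them.

So the crux implies the `textbookFrege` instance of Problem 15.6.1 at every depth and every odd
prime simultaneously, on a single explicit family — a measure of its strength (no superpolynomial
`F_d(MOD_p)` lower bound is known for any family and any `d` above the trivial range).

References: J. Krajíček, *Proof Complexity* (CUP 2019), §15.6, Problem 15.6.1
[KrajicekProofComplexity2019]; S. Buss et al., Comput. Complexity 6 (1996/97), Def. 1.1
[BussImpagliazzoKrajicekPudlakRazborovSgall1997]; G. A. Margulis, Combinatorica 2 (1982)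
[Margulis1982].
-/

noncomputable section

set_option linter.dupNamespace false -- `Summit.PneNP.PneNP.…`: summit = sub-problem (D-0017)

namespace Summit.PneNP.PneNP.Theorems

open Literature.Computability.Complexity Literature.Computability.MetaComplexity
open Summit.PneNP.PneNP.Theses.ExpanderLinearGenerators

/-! ### Polynomials in `ℕ` are dominated by monomials -/

/-- `q(x) ≤ (Σᵢ coeff q i) · y^{deg q}` whenever `x ≤ y` and `1 ≤ y` (coefficients in `ℕ`).
[folklore] -/
theorem polynomial_eval_le_pow (q : Polynomial ℕ) {x y : ℕ} (hxy : x ≤ y) (hy : 1 ≤ y) :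
    q.eval x ≤ (∑ i ∈ Finset.range (q.natDegree + 1), q.coeff i) * y ^ q.natDegree := by
  rw [Polynomial.eval_eq_sum_range, Finset.sum_mul]
  refine Finset.sum_le_sum fun i hi => ?_
  have hi' : i ≤ q.natDegree := Nat.lt_succ_iff.1 (Finset.mem_range.1 hi)
  calc q.coeff i * x ^ i ≤ q.coeff i * y ^ i :=
        Nat.mul_le_mul_left _ (Nat.pow_le_pow_left hxy i)
    _ ≤ q.coeff i * y ^ q.natDegree := Nat.mul_le_mul_left _ (Nat.pow_le_pow_right hy hi')

/-! ### The explicit class of tautologies -/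

/-- **The Margulis–Tseitin targets**: the formulas `¬ ofCNF (sumEncoding 1 E)` of the
`16`-sparse `(n^(1 - 199/200), 3/4·16)`-boundary-expanding unsolvable systems over `𝔽₂` on
`n ≥ 2^200` variables. [cite: Margulis1982, main construction] -/
def margulisTseitinTargets : Set (PropForm ℕ) :=
  {φ | ∃ (n m : ℕ) (E : Fin m → LinEqMod 2 n), 2 ^ 200 ≤ n ∧ (∀ i, (E i).supp.card ≤ 16) ∧
    IsBoundaryExpander (fun i => (E i).supp.map Fin.valEmbedding)
      ((n : ℝ) ^ (1 - (199 / 200 : ℝ))) (3 / 4 * ((16 : ℕ) : ℝ)) ∧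
    ¬ SystemSat E Finset.univ ∧ φ = PropForm.neg (PropForm.ofCNF (sumEncoding 1 E))}

/-- The negation of the XOR-CNF of an unsolvable system is a tautology. [folklore] -/
theorem isTautology_neg_ofCNF_sumEncoding {n m : ℕ} {E : Fin m → LinEqMod 2 n}
    (hE : ¬ SystemSat E Finset.univ) :
    (PropForm.neg (PropForm.ofCNF (sumEncoding 1 E))).IsTautology := by
  intro σ
  have hunsat : ¬ (sumEncoding 1 E).Satisfiable := fun hsat =>
    hE ((sumEncoding_satisfiable_iff (p := 2) (B := 1) (by norm_num) (by norm_num) E).1 hsat)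
  rw [PropForm.eval, PropForm.eval_ofCNF]
  cases h : (sumEncoding 1 E).eval σ
  · rfl
  · exact absurd ⟨σ, h⟩ hunsat

/-- Every Margulis–Tseitin target is a tautology. [folklore] -/
theorem isTautology_of_mem_margulisTseitinTargets {φ : PropForm ℕ}
    (hφ : φ ∈ margulisTseitinTargets) : φ.IsTautology := by
  obtain ⟨n, m, E, -, -, -, hE, rfl⟩ := hφ
  exact isTautology_neg_ofCNF_sumEncoding hE

/-- The class is inhabited at every `n ≥ 2^200` (the Margulis–Tseitin systems).
[cite: Margulis1982, main construction] -/
theorem exists_mem_margulisTseitinTargets {n : ℕ} (hn : 2 ^ 200 ≤ n) :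
    ∃ (m : ℕ) (E : Fin m → LinEqMod 2 n), (∀ i, (E i).supp.card ≤ 16) ∧
      IsBoundaryExpander (fun i => (E i).supp.map Fin.valEmbedding)
        ((n : ℝ) ^ (1 - (199 / 200 : ℝ))) (3 / 4 * ((16 : ℕ) : ℝ)) ∧
      ¬ SystemSat E Finset.univ ∧
      PropForm.neg (PropForm.ofCNF (sumEncoding 1 E)) ∈ margulisTseitinTargets := by
  have hn' : 2 ^ 11 * 800 ^ 8 ≤ n := le_trans (by norm_num) hn
  obtain ⟨m, E, hsp, hexp, hunsat⟩ := FreeCayley.exists_expanding_unsat_system hn'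
  exact ⟨m, E, hsp, hexp, hunsat, n, m, E, hn, hsp, hexp, hunsat, rfl⟩

/-- `2^200 = ⌈2^{1/(1 - 199/200)}⌉`, so `n ≥ 2^200` puts the expansion radius `n^(1/200)` at
`≥ 2`. [folklore] -/
theorem two_le_radius {n : ℕ} (hn : 2 ^ 200 ≤ n) :
    (2 : ℝ) ≤ (n : ℝ) ^ (1 - (199 / 200 : ℝ)) := by
  refine two_le_rpow_of_ceil_le (by norm_num) ?_
  have h : (2 : ℝ) ^ (1 / (1 - (199 / 200 : ℝ))) = ((2 ^ 200 : ℕ) : ℝ) := by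
    rw [show (1 / (1 - (199 / 200 : ℝ))) = ((200 : ℕ) : ℝ) by norm_num, Real.rpow_natCast]
    push_cast
    ring
  rw [h, Nat.ceil_natCast]
  exact hn

/-- **Targets are small**: the size of the target of a `16`-sparse expanding instance on
`n ≥ 2^200` variables is at most `K₁₆ · (n+1)^16`. [folklore] -/
theorem size_target_le {n m : ℕ} (E : Fin m → LinEqMod 2 n) (hn : 2 ^ 200 ≤ n)
    (hsparse : ∀ i, (E i).supp.card ≤ 16)
    (hexp : IsBoundaryExpander (fun i => (E i).supp.map Fin.valEmbedding)
      ((n : ℝ) ^ (1 - (199 / 200 : ℝ))) (3 / 4 * ((16 : ℕ) : ℝ))) :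
    (PropForm.neg (PropForm.ofCNF (sumEncoding 1 E))).size ≤
      ((16 + 1) * (2 ^ 16 * (3 * 16 + 2) + 1) + 4) * (n + 1) ^ 16 := by
  have hinj : Function.Injective fun i => (E i).supp := fun i j hij => by
    by_contra hne
    exact supp_ne_of_expander E (ℓ := 16) (by norm_num) (two_le_radius hn) hexp hne hij
  have h := ModTwo.param_le_of_sparse E (ℓ := 16) (by norm_num) hsparse hinj
  rw [PropForm.size]
  omega

/-! ### The consequence of the crux -/

/-- **`LinearGeneratorModPFregeHard` ⇒ `textbookFrege_d(MOD_p)` is not polynomially bounded on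
the Margulis–Tseitin tautologies, for every odd prime `p` and every depth `d`.**  Suppose a
polynomial `q` bounds the size of some depth-`d` `textbookFrege(MOD_p)` proof of every target in
the class.  The crux at `ℓ = 16`, `δ = 199/200` gives `ε, N`; at any `n ≥ max(N, 2^200, N')` the
Margulis–Tseitin instance has such a proof of size `≤ q(K₁₆ (n+1)^16) ≤ B (K₁₆ (n+1)^16)^D
< 2^(n^ε)` (`N'` from `ModTwo.exists_nat_poly_lt_two_rpow`), contradicting the crux's lower
bound for that very proof.  Hence the crux implies the `textbookFrege` instance of Krajíček's
Problem 15.6.1 at all depths on one explicit family. [cite: KrajicekProofComplexity2019,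
Problem 15.6.1] -/
theorem not_isModDepthPolyBoundedOn_of_linearGeneratorModPFregeHard
    (h : LinearGeneratorModPFregeHard) (p : ℕ) (hp : p.Prime) (hp2 : p ≠ 2) (d : ℕ) :
    ¬ textbookFrege.IsModDepthPolyBoundedOn p d margulisTseitinTargets := by
  rintro ⟨q, hq⟩
  obtain ⟨ε, hε, N, hN⟩ := h p hp hp2 16 d (199 / 200) (by norm_num) (by norm_num) (by norm_num)
  -- the polynomial bound as a monomial in `n`
  set K : ℕ := (16 + 1) * (2 ^ 16 * (3 * 16 + 2) + 1) + 4 with hK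
  set B : ℕ := ∑ i ∈ Finset.range (q.natDegree + 1), q.coeff i with hB
  set D : ℕ := q.natDegree with hD
  obtain ⟨N', hN'⟩ := ModTwo.exists_nat_poly_lt_two_rpow (B * K ^ D) (16 * D) hε
  -- a large instance
  set n : ℕ := max N (max (2 ^ 200) N') with hndef
  have hnN : N ≤ n := le_max_left _ _
  have hn200 : 2 ^ 200 ≤ n := le_trans (le_max_left _ _) (le_max_right _ _)
  have hnN' : N' ≤ n := le_trans (le_max_right _ _) (le_max_right _ _)
  obtain ⟨m, E, hsp, hexp, hunsat, hmem⟩ := exists_mem_margulisTseitinTargets hn200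
  -- the polynomially bounded proof …
  obtain ⟨π, hπ, hsize⟩ := hq _ hmem (isTautology_neg_ofCNF_sumEncoding hunsat)
  -- … is below `2^(n^ε)` …
  have hK1 : 1 ≤ K * (n + 1) ^ 16 := Nat.one_le_iff_ne_zero.2 (by positivity)
  have hq_le : q.eval (PropForm.neg (PropForm.ofCNF (sumEncoding 1 E))).size ≤
      B * K ^ D * (n + 1) ^ (16 * D) := by
    refine (polynomial_eval_le_pow q (size_target_le E hn200 hsp hexp) hK1).trans (le_of_eq ?_)
    rw [hB, hD, Nat.mul_pow, ← pow_mul, mul_assoc]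
  have hlt := hN' n hnN'
  have hup : (modProofSize π : ℝ) < (2 : ℝ) ^ ((n : ℝ) ^ ε) := by
    have h1 : (modProofSize π : ℝ) ≤ ((B * K ^ D * (n + 1) ^ (16 * D) : ℕ) : ℝ) := by
      exact_mod_cast hsize.trans hq_le
    exact h1.trans_lt hlt
  -- … and above it
  have hlow := hN n hnN m E hsp hexp hunsat π hπ
  linarith

end Summit.PneNP.PneNP.Theorems
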